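import Summits.CriticalPhenomena.PercolationContinuityZ3.Theorems.Transplant.SkelPhiForcedColumn
import HarnessLib

/-!
# N2 (frames-only node), (S0) kit tier, Skel side part 1b: **THE FORCED KIT GEOMETRY OF A WINDOW LEVEL** — the forced seed region
# `wired path ∪ column ∪ zone box`, the face `= zone box`, and `Skelφ.kitOK_forced`
# (T4-S0 v1.1 §3/§10; N2-SCOPE §19.1 (d); interface of record (R-16))

builds on p205010 (kernel theorem, internal audit signed; external expert review pending) — nothing in this file uses p205010; nothing here is a
claim about the open node `SamePDropOfSkeletonFrm₁`.
Lane `prim-bschramm`, seat `prim-bschramm-p1` (gen 16); helper file (`--supports stmt-CriticalPhenomena-4575 --as helper`).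

THE (S0) KIT ('force the kit's own seed box').  Two maps as in N1's apron kit (`SkelPhiApronKitDefs`): the WINDOW map `ψ` (levels, contacts, the
wired `ψ`-path of a contact to its stem end `t₁ = ctT1 x` at depth `1 + d`; quasi-steps of cost `N`) and the BASE chart `φ` (unit steps).  Per NEAR
contact `x` with exit side form `F = SF i₀ σ₀`: the COLUMN `ctCol x` = the straight `φ`-walk from `t₁` along `F`'s climbing axis, `K = F.kitK (φ t₁) D A`
steps, ending at `ctColEnd x` over the kit centre's planar point `F.kitPt (φ t₁) D A = φ (ctCtr x)`; the forced SEED REGION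
`S x := ctWire x ∪ ctCol x ∪ Λc (ctCtr x) kz` and the FACE `U x := Λc (ctCtr x) kz` — the route's own source box about N1's kit centre (a datum
`Λc` with `c ∈ Λc c kz`, `Λc c kz ⊆ Rg c`, connected from `c` inside itself, and containing the column's end); FAR contacts: `{y}`, `{y}` (edge-contact
remedy, as N1).  No apron, no exit piece, no absorption.  `Skelφ.kitOK_forced`: this geometry satisfies p1-g9's `KitOK`, so `shyp_kit` gives the
Step-III axioms with seed bound `1 + Δ·cS + cS·cU`.
* (the column: part 1a `SkelPhiForcedColumn`) §1 `ctColEnd_mem_cylBallFin` (the row `hcol` for the fat-prism zone box); §2 **`forcedGeom`**;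
  §3 **`kitOK_forced`**.
[cite: KozmaNitzan2024, §4 Lemma 10, p. 19 (Step III: seeds), p. 26 ((29): columns)] [cite: GrimmettPercolation1999, §7.2]
-/

noncomputable section

open scoped Classical

namespace Summit.CriticalPhenomena.PercolationContinuityZ3.Theorems.Transplant

namespace Skelφ

open Literature.Probability.Percolation Literature.Probability.LatticeModels SimpleGraph KNLevels
open Literature.Probability.Percolation.KozmaNitzan.Cells (oth oth_ne eq_oth_of_ne oth_oth)
open Literature.Barriers.CriticalPhenomena (graphBall graphBall_finite mem_graphBall_self graphBall_mono)
open Skel (winGraph winGraph_adj KitGeom)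
open SkelI (tanOff tanTgt tanTgt_mem)

variable {V : Type} [DecidableEq V] {G : SimpleGraph V} [G.LocallyFinite] {ψ φ : V → Site 2}

/-! ## §1 Discharging the column row for the fat-prism zone box -/

section ColumnZone

variable {Lo Hi : Site 2} (SF : ∀ (i : Fin 2) (σ : ℤˣ), SideForm ψ φ Lo Hi i σ) {P : ApronPrm} {w₀ : V} {R : ℕ}

/-- **The column's end lies in the fat-prism zone box about the kit centre** (the one new geometric row `hcol` of the forced kit, discharged for the
zone box of record `cylBallFin c kz Rk`): the end `c′` and N1's centre `c = ctCtr x` share the planar point and are within graph distance `2·KCmax`,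
so `c′ ∈ prism c (2·KCmax) kz ⊆ cylBall c kz (cylRadMax types kz (2·KCmax))` (`Frames` + connected cylinders); floor `Rk ≥ cylRadMax types kz (2·KCmax)`.
[this work] -/
theorem ctColEnd_mem_cylBallFin {types : Finset V} (hlip : Lip G ψ) (hq : QStepsN G ψ P.N) (hstep : Steps G φ) (hfr : Frames G φ types)
    (hκ : CylConn G φ types) (hw2 : ∀ i, Lo i + 2 ≤ Hi i) {KCmax kz Rk : ℕ}
    (hKC : ∀ (i : Fin 2) (σ : ℤˣ) (z : Site 2), (SF i σ).θ (1 + P.d) ≤ (SF i σ).lin z → (SF i σ).lin z < (SF i σ).θ (2 + P.d) →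
      (SF i σ).kitK z (shellD P) P.A ≤ KCmax)
    (hkz : 1 ≤ kz) (hRk : cylRadMax G φ types kz (2 * KCmax) ≤ Rk)
    {x : V} (hx : x ∈ outerBoundary (winGraph G w₀ R) (Win G ψ w₀ (Finset.Icc Lo Hi) R)) :
    ctColEnd G SF P w₀ R x ∈ cylBallFin G φ (ctCtr G SF P w₀ R x) kz Rk := by
  set c := ctCtr G SF P w₀ R x with hc
  set c' := ctColEnd G SF P w₀ R x with hc'
  have hK := kitK_ctT1_le (SF := SF) (P := P) (w₀ := w₀) (R := R) hlip hq hw2 hKC hx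
  -- both within `kitK ≤ KCmax` of the stem end
  have h1 : c ∈ graphBall G (ctT1 G ψ P w₀ R Lo Hi x) KCmax := graphBall_mono G _ hK (ctCtr_mem_graphBall SF (P := P) (w₀ := w₀) (R := R) hstep x)
  have h2 : c' ∈ graphBall G (ctT1 G ψ P w₀ R Lo Hi x) KCmax := by
    rw [hc']; unfold ctColEnd; exact graphBall_mono G _ hK (walk_mem_graphBall hstep _ _ _ _)
  have hdist : c' ∈ graphBall G c (2 * KCmax) := by
    have := BoxProdZ2.mem_graphBall_add G ((BoxProdZ2.mem_graphBall_comm G).1 h1) h2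
    rwa [two_mul]
  have hcyl : φ c' - φ c ∈ box 2 kz := by
    rw [hc', hc, φ_ctColEnd hstep x, sub_self]; exact (mem_cyl φ c kz c).1 (self_mem_cyl φ c kz) |> fun h => by rwa [sub_self] at h
  rw [mem_cylBallFin]
  exact cylBall_mono G φ c le_rfl hRk (prism_subset_cylBall hfr hκ c hkz (2 * KCmax) ⟨hdist, hcyl⟩)

end ColumnZone

/-! ## §2 The forced kit geometry -/

section Geom

variable (G) {Lo Hi : Site 2} (SF : ∀ (i : Fin 2) (σ : ℤˣ), SideForm ψ φ Lo Hi i σ) (P : ApronPrm) (w₀ : V) (R : ℕ)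
  (Λc : V → ℕ → Finset V) (kz : ℕ)

/-- **The forced kit geometry** of the window level: a NEAR contact gets the seed region `wired path ∪ column ∪ zone box about its kit centre` and the
face `= that zone box`; a FAR contact gets `{y}`, `{y}` (edge-contact remedy). [this work — T4-S0 v1.1 §3/§10] -/
def forcedGeom : KitGeom V where
  y := ctY G ψ w₀ R Lo Hi
  S := fun x => if IsNear G ψ Lo Hi P w₀ R x then ctWire G ψ P w₀ R Lo Hi x ∪ ctCol G SF P w₀ R x ∪ Λc (ctCtr G SF P w₀ R x) kz
    else {ctY G ψ w₀ R Lo Hi x}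
  U := fun x => if IsNear G ψ Lo Hi P w₀ R x then Λc (ctCtr G SF P w₀ R x) kz else {ctY G ψ w₀ R Lo Hi x}

variable {G SF P w₀ R Λc kz}

omit [G.LocallyFinite] in
/-- The face of a near contact. [folklore] -/
theorem forcedGeom_U_of_near {x : V} (h : IsNear G ψ Lo Hi P w₀ R x) : (forcedGeom G SF P w₀ R Λc kz).U x = Λc (ctCtr G SF P w₀ R x) kz := by
  simp only [forcedGeom, if_pos h]

omit [G.LocallyFinite] in
/-- The face of a far contact. [folklore] -/
theorem forcedGeom_U_of_far {x : V} (h : ¬ IsNear G ψ Lo Hi P w₀ R x) : (forcedGeom G SF P w₀ R Λc kz).U x = {ctY G ψ w₀ R Lo Hi x} := by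
  simp only [forcedGeom, if_neg h]

omit [G.LocallyFinite] in
/-- The seed region of a near contact. [folklore] -/
theorem forcedGeom_S_of_near {x : V} (h : IsNear G ψ Lo Hi P w₀ R x) :
    (forcedGeom G SF P w₀ R Λc kz).S x = ctWire G ψ P w₀ R Lo Hi x ∪ ctCol G SF P w₀ R x ∪ Λc (ctCtr G SF P w₀ R x) kz := by
  simp only [forcedGeom, if_pos h]

omit [G.LocallyFinite] in
/-- The seed region of a far contact. [folklore] -/
theorem forcedGeom_S_of_far {x : V} (h : ¬ IsNear G ψ Lo Hi P w₀ R x) : (forcedGeom G SF P w₀ R Λc kz).S x = {ctY G ψ w₀ R Lo Hi x} := by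
  simp only [forcedGeom, if_neg h]

omit [G.LocallyFinite] in
/-- The inner neighbour map. [folklore] -/
theorem forcedGeom_y (x : V) : (forcedGeom G SF P w₀ R Λc kz).y x = ctY G ψ w₀ R Lo Hi x := rfl

omit [G.LocallyFinite] in
/-- The face lies in the seed region. [folklore] -/
theorem forcedGeom_U_subset_S (x : V) : (forcedGeom G SF P w₀ R Λc kz).U x ⊆ (forcedGeom G SF P w₀ R Λc kz).S x := by
  simp only [forcedGeom]
  split_ifs
  · exact Finset.subset_union_right
  · exact subset_rfl

end Geom

/-! ## §3 The forced kit geometry satisfies `KitOK` -/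

section OK

variable {w₀ : V} {R : ℕ}

/-- **THE FORCED KIT GEOMETRY SATISFIES `KitOK`** (the (S0) replacement of N1's `kitOK_apronA`; no apron rows, no absorption): hypotheses = the window
level's widths, the column bound `hKC`, the centre's placement (`0 ≤ A`, `hθA`), the short region `Rg c ⊆ B_G(c, Rs)` with `≤ cU` vertices, and the
zone datum `Λc` (inside `Rg c`, connected from `c` inside itself, containing the column's end), with the radii `r₀ / rs / cS`.
[cite: KozmaNitzan2024, §4 Lemma 10, p. 19 (Step III)] -/
theorem kitOK_forced {lo hi : Site 2} {j : ℕ} (SF : ∀ (i : Fin 2) (σ : ℤˣ), SideForm ψ φ (lo - (j : Site 2)) (hi + (j : Site 2)) i σ)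
    (Rg : V → Finset V) {P : ApronPrm} {KCmax Rs rs cS cU : ℕ}
    (hlip : Lip G ψ) (hq : QStepsN G ψ P.N) (hstep : Steps G φ)
    (hwide : ∀ i, (lo - (j : Site 2)) i + 2 * tanOff P.ℓs P.M ≤ (hi + (j : Site 2)) i)
    (hdw : ∀ i, (lo - (j : Site 2)) i + (P.d + 2 : ℕ) ≤ (hi + (j : Site 2)) i)
    (hKC : ∀ (i : Fin 2) (σ : ℤˣ) (z : Site 2), (SF i σ).θ (1 + P.d) ≤ (SF i σ).lin z → (SF i σ).lin z < (SF i σ).θ (2 + P.d) →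
      (SF i σ).kitK z (shellD P) P.A ≤ KCmax)
    (hA : 0 ≤ P.A) (hθA : ∀ (i : Fin 2) (σ : ℤˣ), (SF i σ).θ (2 + P.d) ≤ (SF i σ).θ (shellD P) + P.A)
    (hr₀ : P.N * (tanOff P.ℓs P.M + 2) + P.N * P.d + (KCmax + Rs) ≤ P.r₀) (hR : P.r₀ ≤ R)
    (hT : (shellD P : ℤ) + KCmax + Rs ≤ tanOff P.ℓs P.M)
    (hDw : ∀ i, (lo - (j : Site 2)) i + ((shellD P + 1 + P.d + KCmax + Rs : ℕ) : ℤ) ≤ (hi + (j : Site 2)) i) (hDρ : Rs + 1 ≤ shellD P)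
    (hRg : ∀ c, ∀ u ∈ Rg c, u ∈ graphBall G c Rs) (hRgcard : ∀ c, (Rg c).card ≤ cU) (hcU1 : 1 ≤ cU)
    (hrs : 1 + (P.N * (tanOff P.ℓs P.M + 2) + P.N * P.d + (KCmax + Rs)) ≤ rs)
    (hcS : (P.N + 1) * (tanOff P.ℓs P.M + 1) + (P.N + 1) * P.d + (KCmax + 1) + cU ≤ cS)
    {Λc : V → ℕ → Finset V} {kz : ℕ} (hΛRg : ∀ c, Λc c kz ⊆ Rg c) (hzconn : ∀ c, ∀ s ∈ Λc c kz, PathIn G (↑(Λc c kz) : Set V) c s)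
    (hcol : ∀ x ∈ outerBoundary (winGraph G w₀ R) (winLevel G ψ w₀ R lo hi j), IsNear G ψ (lo - (j : Site 2)) (hi + (j : Site 2)) P w₀ R x →
      ctColEnd G SF P w₀ R x ∈ Λc (ctCtr G SF P w₀ R x) kz) :
    KitOK G ψ w₀ R lo hi j rs cS cU (forcedGeom G SF P w₀ R Λc kz) := by
  set K := outerBoundary (winGraph G w₀ R) (winLevel G ψ w₀ R lo hi j) with hKdef
  have hKeq : winLevel G ψ w₀ R lo hi j = Win G ψ w₀ (Finset.Icc (lo - (j : Site 2)) (hi + (j : Site 2))) R := rfl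
  have hx' : ∀ x ∈ K, x ∈ outerBoundary (winGraph G w₀ R) (Win G ψ w₀ (Finset.Icc (lo - (j : Site 2)) (hi + (j : Site 2))) R) := fun x hx => hx
  have hw2 : ∀ i, (lo - (j : Site 2)) i + 2 ≤ (hi + (j : Site 2)) i := fun i => by have := hwide i; unfold tanOff at this; omega
  have h1cS : 1 ≤ cS := by omega
  have hy : ∀ x ∈ K, G.Adj x (ctY G ψ w₀ R (lo - (j : Site 2)) (hi + (j : Site 2)) x) ∧ ctY G ψ w₀ R (lo - (j : Site 2)) (hi + (j : Site 2)) x ∈ graphBall G w₀ R ∧ ψ (ctY G ψ w₀ R (lo - (j : Site 2)) (hi + (j : Site 2)) x) ∈ Finset.Icc (lo - (j : Site 2)) (hi + (j : Site 2)) :=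
    fun x hx => inNbr_spec (hx' x hx)
  have hyW : ∀ x ∈ K, ctY G ψ w₀ R (lo - (j : Site 2)) (hi + (j : Site 2)) x ∈ winLevel G ψ w₀ R lo hi j := fun x hx => by rw [hKeq, mem_Win]; exact ⟨(hy x hx).2.1, (hy x hx).2.2⟩
  have hy1 : ∀ x ∈ K, ctY G ψ w₀ R (lo - (j : Site 2)) (hi + (j : Site 2)) x ∈ graphBall G x 1 := fun x hx =>
    BoxProdZ2.mem_graphBall_succ_of_adj G (mem_graphBall_self G x 0) (hy x hx).1
  -- radii from the inner neighbour
  set r₁ : ℕ := P.N * (tanOff P.ℓs P.M + 2) + P.N * P.d + (KCmax + Rs) with hr₁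
  have hNle : P.N * (tanOff P.ℓs P.M + 1) ≤ P.N * (tanOff P.ℓs P.M + 2) := Nat.mul_le_mul_left P.N (by omega)
  have hr₀' : P.N * (tanOff P.ℓs P.M + 1) + P.N * P.d + (KCmax + Rs) ≤ P.r₀ := by omega
  -- the centre, the short region and the zone box
  have hctrB : ∀ x ∈ K, ctCtr G SF P w₀ R x ∈ graphBall G (ctY G ψ w₀ R (lo - (j : Site 2)) (hi + (j : Site 2)) x) (P.N * (tanOff P.ℓs P.M + 1) + P.N * P.d + KCmax) := by
    intro x hx
    have h := ctCtr_mem_graphBall SF (P := P) (w₀ := w₀) (R := R) hstep x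
    exact BoxProdZ2.mem_graphBall_add G (ctT1_mem_graphBall hq hwide (hx' x hx)) (graphBall_mono G _ (kitK_ctT1_le hlip hq hw2 hKC (hx' x hx)) h)
  have hRgB : ∀ x ∈ K, ∀ u ∈ Rg (ctCtr G SF P w₀ R x), u ∈ graphBall G (ctY G ψ w₀ R (lo - (j : Site 2)) (hi + (j : Site 2)) x) r₁ := by
    intro x hx u hu
    have h := BoxProdZ2.mem_graphBall_add G (hctrB x hx) (hRg _ u hu)
    exact graphBall_mono G _ (by omega) h
  have hRgW : ∀ x ∈ K, IsNear G ψ (lo - (j : Site 2)) (hi + (j : Site 2)) P w₀ R x → Rg (ctCtr G SF P w₀ R x) ⊆ winLevel G ψ w₀ R lo hi j := fun x hx hnear v hv =>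
    ball_ctCtr_subset_winLevel SF hlip hq hstep hwide hKC hA hθA hr₀' hR hT hDw hDρ hx hnear v (hRg _ v hv)
  -- the wired path
  have hwireB : ∀ x ∈ K, ∀ v ∈ ctWire G ψ P w₀ R (lo - (j : Site 2)) (hi + (j : Site 2)) x, v ∈ graphBall G (ctY G ψ w₀ R (lo - (j : Site 2)) (hi + (j : Site 2)) x) r₁ := by
    intro x hx v hv
    have h := ctWire_subset_graphBall' hq hwide (hx' x hx) v hv
    exact graphBall_mono G _ (by omega) h
  have hwireW : ∀ x ∈ K, IsNear G ψ (lo - (j : Site 2)) (hi + (j : Site 2)) P w₀ R x → ctWire G ψ P w₀ R (lo - (j : Site 2)) (hi + (j : Site 2)) x ⊆ winLevel G ψ w₀ R lo hi j := by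
    intro x hx hnear v hv
    have hball : v ∈ graphBall G w₀ R := by
      have h := BoxProdZ2.mem_graphBall_add G hnear (graphBall_mono G _ (show r₁ ≤ P.r₀ by omega) (hwireB x hx v hv))
      rwa [Nat.sub_add_cancel hR] at h
    rw [hKeq, mem_Win]
    exact ⟨hball, mem_Icc_of_mem_ctWire hlip hq hwide hdw (hx' x hx) hv⟩
  -- the column
  have hcolB : ∀ x ∈ K, ∀ v ∈ ctCol G SF P w₀ R x, v ∈ graphBall G (ctY G ψ w₀ R (lo - (j : Site 2)) (hi + (j : Site 2)) x) r₁ := by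
    intro x hx v hv
    have h := BoxProdZ2.mem_graphBall_add G (ctT1_mem_graphBall hq hwide (hx' x hx)) (ctCol_subset_graphBall hlip hq hstep hw2 hKC (hx' x hx) v hv)
    exact graphBall_mono G _ (by omega) h
  have hcolW : ∀ x ∈ K, IsNear G ψ (lo - (j : Site 2)) (hi + (j : Site 2)) P w₀ R x → ctCol G SF P w₀ R x ⊆ winLevel G ψ w₀ R lo hi j := fun x hx hnear v hv => by
    rw [hKeq]
    exact mem_winLevel_of_mem_ctCol hlip hq hstep hwide hKC (by omega) hR (by omega)
      (fun i => by have := hDw i; push_cast at this ⊢; omega) (hx' x hx) hnear v hv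
  -- the near region and its connectivity
  have hregB : ∀ x ∈ K, IsNear G ψ (lo - (j : Site 2)) (hi + (j : Site 2)) P w₀ R x → ∀ v ∈ (forcedGeom G SF P w₀ R Λc kz).S x, v ∈ graphBall G (ctY G ψ w₀ R (lo - (j : Site 2)) (hi + (j : Site 2)) x) r₁ := by
    intro x hx hnear v hv
    rw [forcedGeom_S_of_near hnear] at hv
    rcases Finset.mem_union.1 hv with hv | hv
    · rcases Finset.mem_union.1 hv with hv | hv
      · exact hwireB x hx v hv
      · exact hcolB x hx v hv
    · exact hRgB x hx v (hΛRg _ hv)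
  have hregW : ∀ x ∈ K, IsNear G ψ (lo - (j : Site 2)) (hi + (j : Site 2)) P w₀ R x → (forcedGeom G SF P w₀ R Λc kz).S x ⊆ winLevel G ψ w₀ R lo hi j := by
    intro x hx hnear v hv
    rw [forcedGeom_S_of_near hnear] at hv
    rcases Finset.mem_union.1 hv with hv | hv
    · rcases Finset.mem_union.1 hv with hv | hv
      · exact hwireW x hx hnear hv
      · exact hcolW x hx hnear hv
    · exact hRgW x hx hnear (hΛRg _ hv)
  have hregP : ∀ x ∈ K, IsNear G ψ (lo - (j : Site 2)) (hi + (j : Site 2)) P w₀ R x → ∀ v ∈ (forcedGeom G SF P w₀ R Λc kz).S x,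
      PathIn G (↑((forcedGeom G SF P w₀ R Λc kz).S x) : Set V) (ctY G ψ w₀ R (lo - (j : Site 2)) (hi + (j : Site 2)) x) v := by
    intro x hx hnear v hv
    have hSx := forcedGeom_S_of_near (G := G) (SF := SF) (P := P) (w₀ := w₀) (R := R) (Λc := Λc) (kz := kz) hnear
    have hAw : ∀ u ∈ ctWire G ψ P w₀ R (lo - (j : Site 2)) (hi + (j : Site 2)) x, u ∈ (↑((forcedGeom G SF P w₀ R Λc kz).S x) : Set V) := fun u hu => by
      rw [Finset.mem_coe, hSx]; exact Finset.mem_union_left _ (Finset.mem_union_left _ hu)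
    have hAc : (↑(ctCol G SF P w₀ R x) : Set V) ⊆ ↑((forcedGeom G SF P w₀ R Λc kz).S x) := fun u hu => by
      rw [Finset.mem_coe] at hu ⊢; rw [hSx]; exact Finset.mem_union_left _ (Finset.mem_union_right _ hu)
    have hAz : (↑(Λc (ctCtr G SF P w₀ R x) kz) : Set V) ⊆ ↑((forcedGeom G SF P w₀ R Λc kz).S x) := fun u hu => by
      rw [Finset.mem_coe] at hu ⊢; rw [hSx]; exact Finset.mem_union_right _ hu
    have hwire : ∀ u ∈ ctWire G ψ P w₀ R (lo - (j : Site 2)) (hi + (j : Site 2)) x, PathIn G (↑((forcedGeom G SF P w₀ R Λc kz).S x) : Set V) (ctY G ψ w₀ R (lo - (j : Site 2)) (hi + (j : Site 2)) x) u :=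
      fun u hu => by
        unfold ctWire at hu hAw
        exact pathIn_of_wireFinQ_subset hq _ (hw2 _) _ (hy x hx).2.2 hAw u hu
    have ht1 : ctT1 G ψ P w₀ R (lo - (j : Site 2)) (hi + (j : Site 2)) x ∈ ctWire G ψ P w₀ R (lo - (j : Site 2)) (hi + (j : Site 2)) x := by
      unfold ctT1 ctWire; exact stemEnd_mem_wireFinQ hq _ (hw2 _) _ (hy x hx).2.2 P.d
    have hcolP : ∀ u ∈ ctCol G SF P w₀ R x, PathIn G (↑((forcedGeom G SF P w₀ R Λc kz).S x) : Set V) (ctY G ψ w₀ R (lo - (j : Site 2)) (hi + (j : Site 2)) x) u :=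
      fun u hu => (hwire _ ht1).trans ((pathIn_ctCol hstep x u hu).mono hAc)
    rw [hSx] at hv
    rcases Finset.mem_union.1 hv with hv | hv
    · rcases Finset.mem_union.1 hv with hv | hv
      · exact hwire v hv
      · exact hcolP v hv
    · have hend := hcol x hx hnear
      exact (hcolP _ (ctColEnd_mem_ctCol x)).trans
        (((hzconn _ _ hend).symm.trans (hzconn _ v hv)).mono hAz)
  have hregC : ∀ x ∈ K, IsNear G ψ (lo - (j : Site 2)) (hi + (j : Site 2)) P w₀ R x → ((forcedGeom G SF P w₀ R Λc kz).S x).card ≤ cS := by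
    intro x hx hnear
    rw [forcedGeom_S_of_near hnear]
    refine (Finset.card_union_le _ _).trans (le_trans (Nat.add_le_add ((Finset.card_union_le _ _).trans (Nat.add_le_add ?_ ?_)) ?_) hcS)
    · unfold ctWire
      refine (card_wireFinQ_le _ _ _ _ _ _ _ _ _).trans ?_
      have hK' := pathLen_le (φ := ψ) (ℓs := P.ℓs) (M := P.M) (ctDir G ψ w₀ R (lo - (j : Site 2)) (hi + (j : Site 2)) x).1 (hwide (oth _)) (hy x hx).2.2
      exact Nat.add_le_add_right (Nat.mul_le_mul_left _ (by unfold ctY at hK' ⊢; omega)) _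
    · exact card_ctCol_le hlip hq hw2 hKC (hx' x hx)
    · exact (Finset.card_le_card (hΛRg _)).trans (hRgcard _)
  have hfaceC : ∀ x : V, (Λc (ctCtr G SF P w₀ R x) kz).card ≤ cU := fun x => (Finset.card_le_card (hΛRg _)).trans (hRgcard _)
  refine ⟨fun x hx => ?_, fun x hx => ?_, fun x hx => ?_, fun x hx => ?_, fun x hx => ?_, fun x hx => ?_, fun x hx => ?_, fun x hx => ?_,
    fun x hx => ?_, fun x hx => ?_⟩
  · -- adj
    exact (hy x hx).1
  · -- y_mem
    show ctY G ψ w₀ R (lo - (j : Site 2)) (hi + (j : Site 2)) x ∈ (forcedGeom G SF P w₀ R Λc kz).S x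
    by_cases hnear : IsNear G ψ (lo - (j : Site 2)) (hi + (j : Site 2)) P w₀ R x
    · rw [forcedGeom_S_of_near hnear]
      exact Finset.mem_union_left _ (Finset.mem_union_left _ (by unfold ctWire; exact left_mem_wireFinQ _ _ _ _ _ _ _ _ _))
    · rw [forcedGeom_S_of_far hnear]; exact Finset.mem_singleton_self _
  · -- S_sub
    by_cases hnear : IsNear G ψ (lo - (j : Site 2)) (hi + (j : Site 2)) P w₀ R x
    · exact hregW x hx hnear
    · intro v hv
      rw [forcedGeom_S_of_far hnear, Finset.mem_singleton] at hv
      rw [hv]; exact hyW x hx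
  · -- U_sub
    by_cases hnear : IsNear G ψ (lo - (j : Site 2)) (hi + (j : Site 2)) P w₀ R x
    · rw [forcedGeom_U_of_near hnear]; exact (hΛRg _).trans (hRgW x hx hnear)
    · intro u hu
      rw [forcedGeom_U_of_far hnear, Finset.mem_singleton] at hu
      rw [hu]; exact hyW x hx
  · -- S_ball
    intro v hv
    by_cases hnear : IsNear G ψ (lo - (j : Site 2)) (hi + (j : Site 2)) P w₀ R x
    · exact graphBall_mono G x (by omega) (BoxProdZ2.mem_graphBall_add G (hy1 x hx) (hregB x hx hnear v hv))
    · rw [forcedGeom_S_of_far hnear, Finset.mem_singleton] at hv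
      rw [hv]; exact graphBall_mono G x (by omega) (hy1 x hx)
  · -- U_ball
    intro u hu
    by_cases hnear : IsNear G ψ (lo - (j : Site 2)) (hi + (j : Site 2)) P w₀ R x
    · rw [forcedGeom_U_of_near hnear] at hu
      exact graphBall_mono G x (by omega) (BoxProdZ2.mem_graphBall_add G (hy1 x hx) (hRgB x hx u (hΛRg _ hu)))
    · rw [forcedGeom_U_of_far hnear, Finset.mem_singleton] at hu
      rw [hu]; exact graphBall_mono G x (by omega) (hy1 x hx)
  · -- S_path
    intro v hv
    by_cases hnear : IsNear G ψ (lo - (j : Site 2)) (hi + (j : Site 2)) P w₀ R x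
    · exact hregP x hx hnear v hv
    · show PathIn G (↑((forcedGeom G SF P w₀ R Λc kz).S x) : Set V) (ctY G ψ w₀ R (lo - (j : Site 2)) (hi + (j : Site 2)) x) v
      rw [forcedGeom_S_of_far hnear, Finset.mem_singleton] at hv
      rw [forcedGeom_S_of_far hnear, hv]
      exact PathIn.refl (by simp)
  · -- U_adj
    intro u hu
    exact Or.inl (forcedGeom_U_subset_S x hu)
  · -- S_card
    by_cases hnear : IsNear G ψ (lo - (j : Site 2)) (hi + (j : Site 2)) P w₀ R x
    · exact hregC x hx hnear
    · rw [forcedGeom_S_of_far hnear, Finset.card_singleton]; exact h1cS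
  · -- U_card
    by_cases hnear : IsNear G ψ (lo - (j : Site 2)) (hi + (j : Site 2)) P w₀ R x
    · rw [forcedGeom_U_of_near hnear]; exact hfaceC x
    · rw [forcedGeom_U_of_far hnear, Finset.card_singleton]; exact hcU1

end OK

end Skelφ

end Summit.CriticalPhenomena.PercolationContinuityZ3.Theorems.Transplant

end
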